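/-
Copyright (c) 2026 the pub-hodgecm-mathlib formalisation cell (harness21).  Prover seat hodgecm-mathlib-K2E1-p14 (g3) (R90-TF S8 «U(Φ₃) χ-TWIN», (C) FILE 2 ED. 2′ follow-up
named by K2E1-p14 (g2) 17:43Z, unblocked by ★ p862227), Track B «K2-LIT» ENGINE E1, h413 = `stmt-HodgeConjecture-24833`, route `HCCMUnconditional`: the heads of ★
`K2E1ChiSymbolWeylSymmetrySelfDualCMThree` re-keyed to the ★ PAIR section space `chiSectionSpacePair χ₁ χ₂ K′ ω` and to the ★ pair shape `HasReflectedIntertwiningPair`.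
-/
import Summits.HodgeConjecture.HodgeConjecture.Theorems.K2E1ChiSymbolWeylSymmetrySelfDualCMThree  -- ★ p862189 ((C) FILE 2): `chi_symbol_symm_of_selfDual_cm_three`, `chi_symbol_hsymm_of_selfDual_cm_three`
import Summits.HodgeConjecture.HodgeConjecture.Theorems.K2E1ChiSectionSpaceU3PairDefs           -- ★ p862227 (D-S8-3 ED.2): `chiSectionSpacePair`, `HasReflectedIntertwiningPair` + read-backs
import HarnessLib

/-!
# S8 «U(Φ₃) χ-TWIN» — `K2E1ChiSymbolWeylSymmetrySelfDualCMThreePair` ((C) FILE 2 ED. 2′): `s(z) = s(2 − z)` AND `s(1 − it) = s(1 + it)` FOR A SELF-DUAL PAIR ON `U(2,1)_{L∕L⁺}`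
# IN THE ★ PAIR-SPACE CURRENCY `φ ∈ chiSectionSpacePair χ₁ χ₂ K′ ω`, AND WITH THE ONE LETTER `hMne` RE-KEYED TO THE ★ PAIR SHAPE `HasReflectedIntertwiningPair`

Track B ∕ K2-LIT, crux h413 = `stmt-HodgeConjecture-24833`, route of record `HCCMUnconditional`; cell `hodgecm-mathlib`, R90-TF slab S8 (TWIN-DAG (H), row 7b ∕ row 8 consumers at
N = 3).  THEOREMS ONLY (no `def`, no `instance`, no notation, no named-fact hypothesis, no `sorry`; default heartbeats); lane `--supports stmt-HodgeConjecture-24833 --as helper`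
(count-neutral).  CLOSES NO SOCKET.

THE MATHEMATICS ([MoeglinWaldspurger1995, I.2.17, II.1.7, IV.1.10]; [Garrett2018, §2.8]; [Rogawski1990, §13.9 p. 229]).  ★ (C) FILE 2 `chi_symbol_symm_of_selfDual_cm_three` proves, on
`U(2,1)_{L∕L⁺}`, `s(z) = s(2 − z)` for the Hecke symbol `s` of a kernel `h` acting on the measurable bounded `(χ₁, χ₂)`-pair-sections `φ` with right `(K′, ω)`-law (`K′ ≤ K_U`) of a
SELF-DUAL pair (`χ₁ʷ = χ₁`), modulo ONE letter `hMne : ∃ g w₁, 2 < Re w₁ ∧ ∫_N f_{w₁}^φ(w₀ v g) dν ≠ 0`; its §2 gave the `χ₂ = 1` single-character heads over ★ `chiSectionSpace χ K′ ω`.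
Since then the PAIR section space `V(χ₁, χ₂; K′, ω) = chiSectionSpacePair χ₁ χ₂ K′ ω` (★ `K2E1ChiSectionSpaceU3PairDefs`, [MW95, I.2.17]) is in the tree, so the N = 3 consumers can be
fed in ONE currency: §1 re-issues both heads with `hφ : φ ∈ chiSectionSpacePair χ₁ χ₂ K′ ω` and the symbol law `hR` quantified over `ψ ∈ chiSectionSpacePair χ₁ χ₂ K′ ω` (membership
= pair law ∧ right law, ★ `mem_chiSectionSpacePair_iff`).  §2 re-keys the one letter: if `φ′` is a reflected partner of `φ` at `w₁` in the sense of ★ `HasReflectedIntertwiningPair`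
(`∫_N f_{w₁}^φ(w₀ v g) dν = f_{2−w₁}^{φ′}(g)` for every `g`, [MW95, II.1.7]) then `hMne` at `w₁` IS the non-vanishing of the flat section `f_{2−w₁}^{φ′}` at one point — so the heads hold
modulo `∃ g, f_{2−w₁}^{φ′}(g) ≠ 0` for ONE `Re w₁ > 2` (the shape row 8's injectivity-of-`M(w₁)` payer delivers).
* §1 **`chi_symbol_symm_of_selfDual_cm_three_of_memPair`** (`∀ z, s z = s (2 − z)`), **`chi_symbol_hsymm_of_selfDual_cm_three_of_memPair`** (`∀ t, s(1 − it) = s(1 + it)`).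
* §2 **`integral_flatSectionU_weylLongU_ne_zero_of_hasReflectedIntertwiningPair`** (the letter from the pair shape), **`chi_symbol_symm_of_selfDual_cm_three_of_memPair_of_pair`**,
  **`chi_symbol_hsymm_of_selfDual_cm_three_of_memPair_of_pair`**.
HONEST LABEL: HC_CM is proved only modulo the 7 printed citations (2 remaining named inputs: hLiu418 = `stmt-HodgeConjecture-24832`, h413 = `stmt-HodgeConjecture-24833`) until rung 0
closes; this file asserts no named fact, is conditional by construction on its visible letter, and closes no socket; count-neutral.

## References
* [MoeglinWaldspurger1995] C. Mœglin, J.-L. Waldspurger, *Spectral decomposition and Eisenstein series* (1995): I.2.17, II.1.7, IV.1.10.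
* [Garrett2018] P. Garrett, *Modern Analysis of Automorphic Forms by Example* (2018): §2.8.
* [Rogawski1990] J. D. Rogawski, *Automorphic Representations of Unitary Groups in Three Variables* (1990): §13.9 p. 229.
-/

set_option autoImplicit false
set_option linter.dupNamespace false -- the mandated namespace repeats `HodgeConjecture.HodgeConjecture`

noncomputable section

open MeasureTheory Measure NumberField Filter Topology Set Function
open scoped NNReal ENNReal
open Literature.NumberTheory Literature.NumberTheory.Automorphic Literature.NumberTheory.Automorphic.UnitaryGroup AdelicGroupData
open Literature.NumberTheory.GaloisRepresentations (HeckeCharacter)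
open Literature.NumberTheory.Automorphic.Arthur2013.Leaves.TECR
open Summit.HodgeConjecture.HodgeConjecture.Cruxes.H413.K2E1BorelEisensteinU
open Summit.HodgeConjecture.HodgeConjecture.Cruxes.H413.K2E1CharacterEisensteinU2Defs
open Summit.HodgeConjecture.HodgeConjecture.Cruxes.H413.K2E1CharacterEisensteinU3PairDefs
open Summit.HodgeConjecture.HodgeConjecture.Cruxes.H413.K2E1ChiSectionSpaceU3PairDefs
open Summit.HodgeConjecture.HodgeConjecture.Cruxes.H413.K2E1ChiSymbolWeylSymmetrySelfDualCMThree (chi_symbol_symm_of_selfDual_cm_three)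

namespace Summit.HodgeConjecture.HodgeConjecture.Cruxes.H413.K2E1ChiSymbolWeylSymmetrySelfDualCMThreePair

variable (L : Type) [Field L] [NumberField L] [IsCMField L]
  [MeasurableSpace (quasiSplit (↥(maximalRealSubfield L)) L (IsCMField.complexConj L) 3).Adelic] [BorelSpace (quasiSplit (↥(maximalRealSubfield L)) L (IsCMField.complexConj L) 3).Adelic]

/-! ## §1 The heads in the pair-space currency `φ ∈ chiSectionSpacePair χ₁ χ₂ K′ ω` -/

/-- **`s(z) = s(2 − z)` ON `V(χ₁, χ₂; K′, ω) = chiSectionSpacePair χ₁ χ₂ K′ ω` (`U(2,1)_{L∕L⁺}`, SELF-DUAL `χ₁`) MODULO `hMne`**: binders — a Haar measure `ν_G`; the radical package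
`(ν, 𝓕)`; `reflectChar c χ₁ = χ₁`; `K′ ≤ K_U`; `φ ∈ chiSectionSpacePair χ₁ χ₂ K′ ω` measurable bounded; `h ∈ C_c(G(𝔸))` with entire symbol `s` and symbol law `hR` on the members
of `chiSectionSpacePair χ₁ χ₂ K′ ω`; `hMne`.  ★ `chi_symbol_symm_of_selfDual_cm_three` through ★ `mem_chiSectionSpacePair_iff` (membership = pair law ∧ right `(K′, ω)`-law).
[cite: MoeglinWaldspurger1995, I.2.17, IV.1.10] [cite: Garrett2018, §2.8] -/
theorem chi_symbol_symm_of_selfDual_cm_three_of_memPair (νG : Measure (quasiSplit (↥(maximalRealSubfield L)) L (IsCMField.complexConj L) 3).Adelic) [νG.IsHaarMeasure]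
    (ν : Measure ↥(adelicUnipotent (↥(maximalRealSubfield L)) L (IsCMField.complexConj L) 3)) [ν.IsHaarMeasure] [ν.IsInvInvariant]
    {𝓕 : Set ↥(adelicUnipotent (↥(maximalRealSubfield L)) L (IsCMField.complexConj L) 3)}
    (h𝓕N : IsFundamentalDomain ↥(rationalUnipotent (↥(maximalRealSubfield L)) L (IsCMField.complexConj L) 3) 𝓕 ν) (h𝓕c : IsCompact (closure 𝓕))
    {χ₁ : HeckeCharacter L} {χ₂ : ↥(TorusDict.torus (IsCMField.complexConj L)) →ₜ* ℂˣ} (hsd : reflectChar (IsCMField.complexConj L) χ₁ = χ₁)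
    {K' : Subgroup (quasiSplit (↥(maximalRealSubfield L)) L (IsCMField.complexConj L) 3).Adelic} {ω : ↥K' → ℂ}
    (hK'U : K' ≤ ((standardMaximalCompactGL 3 L).comap (adelicVal (↥(maximalRealSubfield L)) L (IsCMField.complexConj L) 3 ((StdForm.antidiagonal 3).over L)) : Subgroup (quasiSplit (↥(maximalRealSubfield L)) L (IsCMField.complexConj L) 3).Adelic))
    {φ : (quasiSplit (↥(maximalRealSubfield L)) L (IsCMField.complexConj L) 3).Adelic → ℂ} (hφ : φ ∈ chiSectionSpacePair χ₁ χ₂ K' ω) (hφm : Measurable φ) {Cφ : ℝ} (hφC : ∀ x, ‖φ x‖ ≤ Cφ)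
    {h : (quasiSplit (↥(maximalRealSubfield L)) L (IsCMField.complexConj L) 3).Adelic → ℂ} (hh : Continuous h) (hhs : HasCompactSupport h) (s : ℂ → ℂ) (hs : Differentiable ℂ s)
    (hR : ∀ (z : ℂ), ∀ ψ ∈ chiSectionSpacePair χ₁ χ₂ K' ω, ∀ x : (quasiSplit (↥(maximalRealSubfield L)) L (IsCMField.complexConj L) 3).Adelic,
      ∫ y, h y * flatSectionU ψ z (x * y) ∂νG = s z * flatSectionU ψ z x)
    (hMne : ∃ (g : (quasiSplit (↥(maximalRealSubfield L)) L (IsCMField.complexConj L) 3).Adelic) (w₁ : ℂ), 2 < w₁.re ∧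
      ∫ v : ↥(adelicUnipotent (↥(maximalRealSubfield L)) L (IsCMField.complexConj L) 3), flatSectionU φ w₁
        ((quasiSplit (↥(maximalRealSubfield L)) L (IsCMField.complexConj L) 3).toAdelic (weylLongU ((IsCMField.complexConj L : L ≃ₐ[↥(maximalRealSubfield L)] L) : L →+* L) (rfl : (StdForm.antidiagonal 3).over L = (StdForm.antidiagonal 3).over L)) *
          ((v : (quasiSplit (↥(maximalRealSubfield L)) L (IsCMField.complexConj L) 3).Adelic) * g)) ∂ν ≠ 0)
    (z : ℂ) : s z = s (2 - z) :=
  chi_symbol_symm_of_selfDual_cm_three L νG ν h𝓕N h𝓕c hsd hK'U (isChiSectionPair_of_mem hφ) (fun g k => apply_mul_of_mem hφ g k) hφm hφC hh hhs s hs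
    (fun z ψ hψ hψK x => hR z ψ (mem_chiSectionSpacePair hψ hψK) x) hMne z

/-- **`hsymm` ON `V(χ₁, χ₂; K′, ω)` (`U(2,1)_{L∕L⁺}`, SELF-DUAL `χ₁`) MODULO `hMne`**: `∀ t, s(1 − it) = s(1 + it)` (centre `z = 1`) — §1 at `z = 1 + it`.
[cite: MoeglinWaldspurger1995, I.2.17, IV.1.10] [cite: Garrett2018, §2.8] -/
theorem chi_symbol_hsymm_of_selfDual_cm_three_of_memPair (νG : Measure (quasiSplit (↥(maximalRealSubfield L)) L (IsCMField.complexConj L) 3).Adelic) [νG.IsHaarMeasure]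
    (ν : Measure ↥(adelicUnipotent (↥(maximalRealSubfield L)) L (IsCMField.complexConj L) 3)) [ν.IsHaarMeasure] [ν.IsInvInvariant]
    {𝓕 : Set ↥(adelicUnipotent (↥(maximalRealSubfield L)) L (IsCMField.complexConj L) 3)}
    (h𝓕N : IsFundamentalDomain ↥(rationalUnipotent (↥(maximalRealSubfield L)) L (IsCMField.complexConj L) 3) 𝓕 ν) (h𝓕c : IsCompact (closure 𝓕))
    {χ₁ : HeckeCharacter L} {χ₂ : ↥(TorusDict.torus (IsCMField.complexConj L)) →ₜ* ℂˣ} (hsd : reflectChar (IsCMField.complexConj L) χ₁ = χ₁)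
    {K' : Subgroup (quasiSplit (↥(maximalRealSubfield L)) L (IsCMField.complexConj L) 3).Adelic} {ω : ↥K' → ℂ}
    (hK'U : K' ≤ ((standardMaximalCompactGL 3 L).comap (adelicVal (↥(maximalRealSubfield L)) L (IsCMField.complexConj L) 3 ((StdForm.antidiagonal 3).over L)) : Subgroup (quasiSplit (↥(maximalRealSubfield L)) L (IsCMField.complexConj L) 3).Adelic))
    {φ : (quasiSplit (↥(maximalRealSubfield L)) L (IsCMField.complexConj L) 3).Adelic → ℂ} (hφ : φ ∈ chiSectionSpacePair χ₁ χ₂ K' ω) (hφm : Measurable φ) {Cφ : ℝ} (hφC : ∀ x, ‖φ x‖ ≤ Cφ)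
    {h : (quasiSplit (↥(maximalRealSubfield L)) L (IsCMField.complexConj L) 3).Adelic → ℂ} (hh : Continuous h) (hhs : HasCompactSupport h) (s : ℂ → ℂ) (hs : Differentiable ℂ s)
    (hR : ∀ (z : ℂ), ∀ ψ ∈ chiSectionSpacePair χ₁ χ₂ K' ω, ∀ x : (quasiSplit (↥(maximalRealSubfield L)) L (IsCMField.complexConj L) 3).Adelic,
      ∫ y, h y * flatSectionU ψ z (x * y) ∂νG = s z * flatSectionU ψ z x)
    (hMne : ∃ (g : (quasiSplit (↥(maximalRealSubfield L)) L (IsCMField.complexConj L) 3).Adelic) (w₁ : ℂ), 2 < w₁.re ∧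
      ∫ v : ↥(adelicUnipotent (↥(maximalRealSubfield L)) L (IsCMField.complexConj L) 3), flatSectionU φ w₁
        ((quasiSplit (↥(maximalRealSubfield L)) L (IsCMField.complexConj L) 3).toAdelic (weylLongU ((IsCMField.complexConj L : L ≃ₐ[↥(maximalRealSubfield L)] L) : L →+* L) (rfl : (StdForm.antidiagonal 3).over L = (StdForm.antidiagonal 3).over L)) *
          ((v : (quasiSplit (↥(maximalRealSubfield L)) L (IsCMField.complexConj L) 3).Adelic) * g)) ∂ν ≠ 0)
    (t : ℝ) : s (1 - t * Complex.I) = s (1 + t * Complex.I) := by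
  have h1 := chi_symbol_symm_of_selfDual_cm_three_of_memPair L νG ν h𝓕N h𝓕c hsd hK'U hφ hφm hφC hh hhs s hs hR hMne (1 + t * Complex.I)
  rw [h1]
  congr 1
  ring

/-! ## §2 The one letter re-keyed to the ★ pair shape `HasReflectedIntertwiningPair χ₁ χ₂ ν φ φ′ w₁` -/

omit [BorelSpace (quasiSplit (↥(maximalRealSubfield L)) L (IsCMField.complexConj L) 3).Adelic] in
/-- **THE LETTER FROM THE PAIR SHAPE**: if `φ′` is a reflected partner of `φ` at `w₁` (★ `HasReflectedIntertwiningPair`: `∫_N f_{w₁}^φ(w₀ v g) dν = f_{2−w₁}^{φ′}(g)` for every `g`) and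
the flat section `f_{2−w₁}^{φ′}` is non-zero at `g`, then `∫_N f_{w₁}^φ(w₀ v g) dν ≠ 0` (the integrand re-associated `w₀ (v g) = (w₀ v) g`). [cite: MoeglinWaldspurger1995, II.1.7] -/
theorem integral_flatSectionU_weylLongU_ne_zero_of_hasReflectedIntertwiningPair
    (ν : Measure ↥(adelicUnipotent (↥(maximalRealSubfield L)) L (IsCMField.complexConj L) 3))
    {χ₁ : HeckeCharacter L} {χ₂ : ↥(TorusDict.torus (IsCMField.complexConj L)) →ₜ* ℂˣ}
    {φ φ' : (quasiSplit (↥(maximalRealSubfield L)) L (IsCMField.complexConj L) 3).Adelic → ℂ} {w₁ : ℂ}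
    (hM : HasReflectedIntertwiningPair χ₁ χ₂ ν φ φ' w₁) {g : (quasiSplit (↥(maximalRealSubfield L)) L (IsCMField.complexConj L) 3).Adelic} (hne : flatSectionU φ' (2 - w₁) g ≠ 0) :
    ∫ v : ↥(adelicUnipotent (↥(maximalRealSubfield L)) L (IsCMField.complexConj L) 3), flatSectionU φ w₁
      ((quasiSplit (↥(maximalRealSubfield L)) L (IsCMField.complexConj L) 3).toAdelic (weylLongU ((IsCMField.complexConj L : L ≃ₐ[↥(maximalRealSubfield L)] L) : L →+* L) (rfl : (StdForm.antidiagonal 3).over L = (StdForm.antidiagonal 3).over L)) *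
        ((v : (quasiSplit (↥(maximalRealSubfield L)) L (IsCMField.complexConj L) 3).Adelic) * g)) ∂ν ≠ 0 := by
  simp_rw [← mul_assoc]
  rw [hM.integral_eq g]
  exact hne

/-- **`s(z) = s(2 − z)` ON `chiSectionSpacePair χ₁ χ₂ K′ ω` (`U(2,1)_{L∕L⁺}`, SELF-DUAL `χ₁`) MODULO A REFLECTED PARTNER NON-ZERO AT ONE POINT**: the letter `hMne` of §1 replaced by
`hM : HasReflectedIntertwiningPair χ₁ χ₂ ν φ φ′ w₁` at ONE `Re w₁ > 2` and `hne : ∃ g, f_{2−w₁}^{φ′}(g) ≠ 0`. [cite: MoeglinWaldspurger1995, II.1.7, IV.1.10] [cite: Garrett2018, §2.8] -/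
theorem chi_symbol_symm_of_selfDual_cm_three_of_memPair_of_pair (νG : Measure (quasiSplit (↥(maximalRealSubfield L)) L (IsCMField.complexConj L) 3).Adelic) [νG.IsHaarMeasure]
    (ν : Measure ↥(adelicUnipotent (↥(maximalRealSubfield L)) L (IsCMField.complexConj L) 3)) [ν.IsHaarMeasure] [ν.IsInvInvariant]
    {𝓕 : Set ↥(adelicUnipotent (↥(maximalRealSubfield L)) L (IsCMField.complexConj L) 3)}
    (h𝓕N : IsFundamentalDomain ↥(rationalUnipotent (↥(maximalRealSubfield L)) L (IsCMField.complexConj L) 3) 𝓕 ν) (h𝓕c : IsCompact (closure 𝓕))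
    {χ₁ : HeckeCharacter L} {χ₂ : ↥(TorusDict.torus (IsCMField.complexConj L)) →ₜ* ℂˣ} (hsd : reflectChar (IsCMField.complexConj L) χ₁ = χ₁)
    {K' : Subgroup (quasiSplit (↥(maximalRealSubfield L)) L (IsCMField.complexConj L) 3).Adelic} {ω : ↥K' → ℂ}
    (hK'U : K' ≤ ((standardMaximalCompactGL 3 L).comap (adelicVal (↥(maximalRealSubfield L)) L (IsCMField.complexConj L) 3 ((StdForm.antidiagonal 3).over L)) : Subgroup (quasiSplit (↥(maximalRealSubfield L)) L (IsCMField.complexConj L) 3).Adelic))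
    {φ : (quasiSplit (↥(maximalRealSubfield L)) L (IsCMField.complexConj L) 3).Adelic → ℂ} (hφ : φ ∈ chiSectionSpacePair χ₁ χ₂ K' ω) (hφm : Measurable φ) {Cφ : ℝ} (hφC : ∀ x, ‖φ x‖ ≤ Cφ)
    {h : (quasiSplit (↥(maximalRealSubfield L)) L (IsCMField.complexConj L) 3).Adelic → ℂ} (hh : Continuous h) (hhs : HasCompactSupport h) (s : ℂ → ℂ) (hs : Differentiable ℂ s)
    (hR : ∀ (z : ℂ), ∀ ψ ∈ chiSectionSpacePair χ₁ χ₂ K' ω, ∀ x : (quasiSplit (↥(maximalRealSubfield L)) L (IsCMField.complexConj L) 3).Adelic,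
      ∫ y, h y * flatSectionU ψ z (x * y) ∂νG = s z * flatSectionU ψ z x)
    {φ' : (quasiSplit (↥(maximalRealSubfield L)) L (IsCMField.complexConj L) 3).Adelic → ℂ} {w₁ : ℂ} (hw₁ : 2 < w₁.re) (hM : HasReflectedIntertwiningPair χ₁ χ₂ ν φ φ' w₁)
    (hne : ∃ g : (quasiSplit (↥(maximalRealSubfield L)) L (IsCMField.complexConj L) 3).Adelic, flatSectionU φ' (2 - w₁) g ≠ 0)
    (z : ℂ) : s z = s (2 - z) := by
  obtain ⟨g, hg⟩ := hne
  exact chi_symbol_symm_of_selfDual_cm_three_of_memPair L νG ν h𝓕N h𝓕c hsd hK'U hφ hφm hφC hh hhs s hs hR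
    ⟨g, w₁, hw₁, integral_flatSectionU_weylLongU_ne_zero_of_hasReflectedIntertwiningPair L ν hM hg⟩ z

/-- **`hsymm` ON `chiSectionSpacePair χ₁ χ₂ K′ ω` MODULO A REFLECTED PARTNER NON-ZERO AT ONE POINT**: `∀ t, s(1 − it) = s(1 + it)`.
[cite: MoeglinWaldspurger1995, II.1.7, IV.1.10] [cite: Garrett2018, §2.8] -/
theorem chi_symbol_hsymm_of_selfDual_cm_three_of_memPair_of_pair (νG : Measure (quasiSplit (↥(maximalRealSubfield L)) L (IsCMField.complexConj L) 3).Adelic) [νG.IsHaarMeasure]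
    (ν : Measure ↥(adelicUnipotent (↥(maximalRealSubfield L)) L (IsCMField.complexConj L) 3)) [ν.IsHaarMeasure] [ν.IsInvInvariant]
    {𝓕 : Set ↥(adelicUnipotent (↥(maximalRealSubfield L)) L (IsCMField.complexConj L) 3)}
    (h𝓕N : IsFundamentalDomain ↥(rationalUnipotent (↥(maximalRealSubfield L)) L (IsCMField.complexConj L) 3) 𝓕 ν) (h𝓕c : IsCompact (closure 𝓕))
    {χ₁ : HeckeCharacter L} {χ₂ : ↥(TorusDict.torus (IsCMField.complexConj L)) →ₜ* ℂˣ} (hsd : reflectChar (IsCMField.complexConj L) χ₁ = χ₁)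
    {K' : Subgroup (quasiSplit (↥(maximalRealSubfield L)) L (IsCMField.complexConj L) 3).Adelic} {ω : ↥K' → ℂ}
    (hK'U : K' ≤ ((standardMaximalCompactGL 3 L).comap (adelicVal (↥(maximalRealSubfield L)) L (IsCMField.complexConj L) 3 ((StdForm.antidiagonal 3).over L)) : Subgroup (quasiSplit (↥(maximalRealSubfield L)) L (IsCMField.complexConj L) 3).Adelic))
    {φ : (quasiSplit (↥(maximalRealSubfield L)) L (IsCMField.complexConj L) 3).Adelic → ℂ} (hφ : φ ∈ chiSectionSpacePair χ₁ χ₂ K' ω) (hφm : Measurable φ) {Cφ : ℝ} (hφC : ∀ x, ‖φ x‖ ≤ Cφ)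
    {h : (quasiSplit (↥(maximalRealSubfield L)) L (IsCMField.complexConj L) 3).Adelic → ℂ} (hh : Continuous h) (hhs : HasCompactSupport h) (s : ℂ → ℂ) (hs : Differentiable ℂ s)
    (hR : ∀ (z : ℂ), ∀ ψ ∈ chiSectionSpacePair χ₁ χ₂ K' ω, ∀ x : (quasiSplit (↥(maximalRealSubfield L)) L (IsCMField.complexConj L) 3).Adelic,
      ∫ y, h y * flatSectionU ψ z (x * y) ∂νG = s z * flatSectionU ψ z x)
    {φ' : (quasiSplit (↥(maximalRealSubfield L)) L (IsCMField.complexConj L) 3).Adelic → ℂ} {w₁ : ℂ} (hw₁ : 2 < w₁.re) (hM : HasReflectedIntertwiningPair χ₁ χ₂ ν φ φ' w₁)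
    (hne : ∃ g : (quasiSplit (↥(maximalRealSubfield L)) L (IsCMField.complexConj L) 3).Adelic, flatSectionU φ' (2 - w₁) g ≠ 0)
    (t : ℝ) : s (1 - t * Complex.I) = s (1 + t * Complex.I) := by
  have h1 := chi_symbol_symm_of_selfDual_cm_three_of_memPair_of_pair L νG ν h𝓕N h𝓕c hsd hK'U hφ hφm hφC hh hhs s hs hR hw₁ hM hne (1 + t * Complex.I)
  rw [h1]
  congr 1
  ring

end Summit.HodgeConjecture.HodgeConjecture.Cruxes.H413.K2E1ChiSymbolWeylSymmetrySelfDualCMThreePair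

end
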